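import Summits.QuantumFields.YangMills.Theorems.SwapVirialDeficitSigmaTwistedLetterCeilingAlgebra
import Summits.QuantumFields.YangMills.Theorems.UV3WindowNetSU2
import HarnessLib

/-!
# The σ-twisted four-leader small ball, CEILING side — II: shell boxes of the two inner letters and their cone mass

(Overview of the four-file chain `…SigmaTwistedLetterCeiling{Algebra,Shells,Haar,}.lean` and of the reduction — slaved letter, region A by
the three-letter ceiling, region B by the four load-bearing constraints and dyadic shells against slabs — in the header of part I,
`SwapVirialDeficitSigmaTwistedLetterCeilingAlgebra.lean`.)

This file: §4 — at a fixed unit outer letter `q₃` with `|re q₃| < 1/2`, the straightened ball-model inner letters `(x₀, x₂)` obeying (b), (c),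
(d), (a) lie in the core boxes or, on the dyadic shell `k ≤ K` of the transversal part of `x₀`, in the shell boxes with the outer letter in the slab
`|re q₃| ≤ 2t·2^{k+1}` (✓`mem_boxes_of_constraints`); hence the product cone mass is `≤ Σ_k 𝟙{|re q₃| ≤ 2t·2^{k+1}}·c²·2048t⁴ + c²·256t⁴`
(✓`pi_cone_constraints_le`; rotated boxes through ✓`conjIso`, ✓`volume_quatBox`).
HONEST LABEL: finite-dimensional Haar-volume bookkeeping toward the fixed-`L` zero-mode factor of the swap-glued femto ring (a prediction row of a
DRAFT line); nothing about ⟨24197⟩/⟨24194⟩/⟨24497⟩ or any rung is proved; the Yang–Mills mass gap is NOT proved; no summit is proved by a line.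
Seat ym-line-sfw-p2 g93 (LEAD of unit sfw-p2, free hands; `--supports stmt-QuantumFields-24197`).  THEOREMS ONLY (0 `def`, 0 `sorry`),
standard axioms.  References: [cite: Vanbaal2001]; [cite: Luscher1983, §2]; [cite: GonzalezarroyoAltes1988]; [folklore].
-/

set_option autoImplicit false

noncomputable section

open MeasureTheory Quaternion Set
open scoped Quaternion ENNReal BigOperators
open Literature.MathematicalPhysics.QuantumLattice
open Literature.MathematicalPhysics.QuantumFieldTheory (haarProbability)
open Summit.QuantumFields.YangMills.Theorems.SwapTwistDeficit.ToronLog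
open Summit.QuantumFields.YangMills.Theorems.ToronValleyVolume.NearlyCommutingCeiling
open Summit.QuantumFields.YangMills.Theorems.SwapVirialDeficit
open Summit.QuantumFields.YangMills.Theorems.UV3WindowNetSU2 (abs_imI_le_norm abs_imJ_le_norm abs_imK_le_norm)

namespace Summit.QuantumFields.YangMills.Theorems.SwapVirialDeficit.SigmaTwistedCeiling

/-! ## §4 Shell boxes for the two inner letters at a fixed outer letter, and their cone mass -/

/-- `|a|·max(|p|,|q|) ≤ t` from `|a|·|p| ≤ t` and `|a|·|q| ≤ t`. [folklore] -/
theorem mul_max_abs_le {a p q t : ℝ} (hp : a * |p| ≤ t) (hq : a * |q| ≤ t) : a * max |p| |q| ≤ t := by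
  rcases le_total |p| |q| with h | h
  · rw [max_eq_right h]; exact hq
  · rw [max_eq_left h]; exact hp

/-- From `a · m ≤ t` with `(1/2)^{k+1} < m`: `a ≤ t·2^{k+1}` (for `0 ≤ t`). [folklore] -/
theorem le_mul_two_pow_of_mul_le {a m t : ℝ} {k : ℕ} (ht : 0 ≤ t) (hm : (1 / 2 : ℝ) ^ (k + 1) < m)
    (h : a * m ≤ t) : a ≤ t * 2 ^ (k + 1) := by
  have hm0 : 0 < m := lt_trans (by positivity) hm
  have h1 : a ≤ t / m := by rw [le_div_iff₀ hm0]; exact h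
  refine h1.trans ?_
  rw [div_le_iff₀ hm0]
  have h2 : (1 : ℝ) < m * 2 ^ (k + 1) := by
    rw [one_div, inv_pow] at hm
    have := (inv_lt_iff_one_lt_mul₀ (by positivity)).1 hm
    linarith
  nlinarith

/-- ★ **Shell boxes.**  At a unit outer letter `q₃` with `|re q₃| < 1/2`, straightened by `u`, two ball-model letters `x₀, x₂` obeying the
four load-bearing constraints (b) `‖[q₃,x₂]‖ ≤ t`, (c) `|re q₃|·‖[q₃,x₀]‖ ≤ 2t`, (d) `‖[x₀, q̄₃x₀q₃]‖ ≤ 3t`, (a) `‖[x₀,x₂]‖ ≤ t` have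
straightened coordinates EITHER in the core boxes (`|im_J|, |im_K| ≤ t` for both) OR, for the dyadic shell `k ≤ K` of
`m₀ = max(|im_J y₀|, |im_K y₀|)`, in the shell boxes `|im_I y₀| ≤ t·2^{k+1}`, `|im_{J,K} y₀| ≤ 2^{-k}`, `|im_I y₂| ≤ 2t·2^{k+1}`,
`|im_{J,K} y₂| ≤ t` — and then the outer letter is confined to the slab `|re q₃| ≤ 2t·2^{k+1}`. [folklore] -/
theorem mem_boxes_of_constraints {q₃ u x₀ x₂ : ℍ} {t : ℝ} {K : ℕ} (h₃ : ‖q₃‖ = 1) (hr : |q₃.re| < 1 / 2) (hu : ‖u‖ = 1)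
    (hstr : star u * q₃ * u = axisPoint q₃ ∨ star u * q₃ * u = star (axisPoint q₃)) (ht : 0 ≤ t)
    (hK : (1 / 2 : ℝ) ^ (K + 1) ≤ t) (hx₀ : ‖x₀‖ < 1) (hx₂ : ‖x₂‖ < 1)
    (hb : ‖q₃ * x₂ - x₂ * q₃‖ ≤ t) (hc : |q₃.re| * ‖q₃ * x₀ - x₀ * q₃‖ ≤ 2 * t)
    (hd : ‖x₀ * (star q₃ * x₀ * q₃) - (star q₃ * x₀ * q₃) * x₀‖ ≤ 3 * t) (ha : ‖x₀ * x₂ - x₂ * x₀‖ ≤ t) :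
    (star u * x₀ * u ∈ quatBox ![-1, -1, -t, -t] ![1, 1, t, t] ∧ star u * x₂ * u ∈ quatBox ![-1, -1, -t, -t] ![1, 1, t, t]) ∨
      ∃ k ∈ Finset.range (K + 1), |q₃.re| ≤ 2 * t * 2 ^ (k + 1) ∧
        star u * x₀ * u ∈ quatBox ![-1, -(t * 2 ^ (k + 1)), -((1 / 2 : ℝ) ^ k), -((1 / 2 : ℝ) ^ k)]
          ![1, t * 2 ^ (k + 1), (1 / 2 : ℝ) ^ k, (1 / 2 : ℝ) ^ k] ∧
        star u * x₂ * u ∈ quatBox ![-1, -(2 * t * 2 ^ (k + 1)), -t, -t] ![1, 2 * t * 2 ^ (k + 1), t, t] := by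
  set y₀ := star u * x₀ * u with hy₀
  set y₂ := star u * x₂ * u with hy₂
  have hn₀ : ‖y₀‖ < 1 := by rw [hy₀, norm_conj_of_norm_eq_one hu]; exact hx₀
  have hn₂ : ‖y₂‖ < 1 := by rw [hy₂, norm_conj_of_norm_eq_one hu]; exact hx₂
  have hre₀ := abs_le.1 ((abs_re_le_norm y₀).trans hn₀.le)
  have hre₂ := abs_le.1 ((abs_re_le_norm y₂).trans hn₂.le)
  have hI₀' : |y₀.imI| ≤ 1 := (abs_imI_le_norm y₀).trans hn₀.le
  have hI₂' : |y₂.imI| ≤ 1 := (abs_imI_le_norm y₂).trans hn₂.le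
  have hI₀ := abs_le.1 hI₀'
  have hI₂ := abs_le.1 hI₂'
  have hJ₀1 : |y₀.imJ| ≤ 1 := (abs_imJ_le_norm y₀).trans hn₀.le
  have hK₀1 : |y₀.imK| ≤ 1 := (abs_imK_le_norm y₀).trans hn₀.le
  obtain ⟨hJ₂, hK₂⟩ := absJK_le_of_comm_le h₃ hr hu hstr ht hb
  obtain ⟨hcJ, hcK⟩ := abs_re_mul_absJK_le h₃ hr hu hstr ht hc
  obtain ⟨hdJ, hdK⟩ := absI_mul_absJK_le h₃ hr hu hstr ht hd
  obtain ⟨haJ, haK⟩ := absI₂_mul_absJK₀_le hu hx₀ ht hJ₂ hK₂ ha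
  have hJ₂' := abs_le.1 hJ₂
  have hK₂' := abs_le.1 hK₂
  -- the transversal size of `y₀`
  set m₀ := max |y₀.imJ| |y₀.imK| with hm₀
  have hm1 : m₀ ≤ 1 := max_le hJ₀1 hK₀1
  by_cases hcore : m₀ ≤ (1 / 2 : ℝ) ^ (K + 1)
  · -- core: both transversal coordinates of `y₀` are `≤ t`
    left
    have hJ := abs_le.1 (((le_max_left _ _).trans hcore).trans hK : |y₀.imJ| ≤ t)
    have hK' := abs_le.1 (((le_max_right _ _).trans hcore).trans hK : |y₀.imK| ≤ t)
    simp only [quatBox, Set.mem_setOf_eq, Matrix.cons_val_zero, Matrix.cons_val_one, Matrix.cons_val]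
    exact ⟨⟨hre₀.1, hre₀.2, hI₀.1, hI₀.2, hJ.1, hJ.2, hK'.1, hK'.2⟩, ⟨hre₂.1, hre₂.2, hI₂.1, hI₂.2, hJ₂'.1, hJ₂'.2, hK₂'.1, hK₂'.2⟩⟩
  · right
    obtain ⟨k, hk, hlo, hhi⟩ := exists_shell hm1 (not_le.1 hcore)
    refine ⟨k, hk, ?_, ?_, ?_⟩
    · exact le_mul_two_pow_of_mul_le (by positivity) hlo (mul_max_abs_le hcJ hcK)
    · have hI : |y₀.imI| ≤ t * 2 ^ (k + 1) := le_mul_two_pow_of_mul_le ht hlo (mul_max_abs_le hdJ hdK)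
      have hI' := abs_le.1 hI
      have hJ := abs_le.1 ((le_max_left _ _).trans hhi : |y₀.imJ| ≤ (1 / 2 : ℝ) ^ k)
      have hK' := abs_le.1 ((le_max_right _ _).trans hhi : |y₀.imK| ≤ (1 / 2 : ℝ) ^ k)
      simp only [quatBox, Set.mem_setOf_eq, Matrix.cons_val_zero, Matrix.cons_val_one, Matrix.cons_val]
      exact ⟨hre₀.1, hre₀.2, hI'.1, hI'.2, hJ.1, hJ.2, hK'.1, hK'.2⟩
    · have hI : |y₂.imI| ≤ 2 * t * 2 ^ (k + 1) := by
        have := le_mul_two_pow_of_mul_le (by positivity : (0 : ℝ) ≤ 2 * t) hlo (mul_max_abs_le haJ haK)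
        linarith
      have hI' := abs_le.1 hI
      simp only [quatBox, Set.mem_setOf_eq, Matrix.cons_val_zero, Matrix.cons_val_one, Matrix.cons_val]
      exact ⟨hre₂.1, hre₂.2, hI'.1, hI'.2, hJ₂'.1, hJ₂'.2, hK₂'.1, hK₂'.2⟩

section ConeMass

attribute [local instance] Literature.Analysis.FluidPDE.Tao2016.quatMeasurableSpace
  Literature.Analysis.FluidPDE.Tao2016.quatBorelSpace
  Literature.MathematicalPhysics.QuantumLattice.secondCountableTopology_su2

/-- The cone measure is dominated by `c·vol`. [folklore] -/
theorem coneMeasure_le_mul_volume (A : Set ℍ) : coneMeasure A ≤ ENNReal.ofReal coneConst * volume A := by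
  rw [coneMeasure, Measure.smul_apply, smul_eq_mul, inv_volume_ball_eq]
  gcongr
  exact Measure.restrict_le_self

/-- ★ **Cone mass of a rotated coordinate box**: `cone((ū·u)⁻¹ Box) ≤ c · Π sides`. [folklore] -/
theorem coneMeasure_preimage_conj_quatBox_le {u : ℍ} (hu : ‖u‖ = 1) {lo hi : Fin 4 → ℝ} (h : ∀ i, lo i ≤ hi i) :
    coneMeasure ((fun x : ℍ => star u * x * u) ⁻¹' quatBox lo hi) ≤
      ENNReal.ofReal (coneConst * ((hi 0 - lo 0) * (hi 1 - lo 1) * (hi 2 - lo 2) * (hi 3 - lo 3))) := by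
  have e : (fun x : ℍ => star u * x * u) ⁻¹' quatBox lo hi = (conjIso u hu) ⁻¹' quatBox lo hi := by
    ext x; simp [conjIso_apply]
  refine (coneMeasure_le_mul_volume _).trans ?_
  rw [e, (conjIso u hu).measurePreserving.measure_preimage (measurableSet_quatBox lo hi).nullMeasurableSet, volume_quatBox h,
    ← ENNReal.ofReal_mul coneConst_pos.le]

/-- Product cone mass of a two-letter product event. [folklore] -/
theorem pi_two_apply_prod (U V : Set ℍ) :
    (Measure.pi fun _ : Fin 2 => coneMeasure) {x : Fin 2 → ℍ | x 0 ∈ U ∧ x 1 ∈ V} = coneMeasure U * coneMeasure V := by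
  haveI := isProbabilityMeasure_coneMeasure
  have e : {x : Fin 2 → ℍ | x 0 ∈ U ∧ x 1 ∈ V} = Set.pi Set.univ (fun j : Fin 2 => if j = 0 then U else V) := by
    ext x
    simp only [Set.mem_setOf_eq, Set.mem_pi, Set.mem_univ, true_implies, Fin.forall_fin_two, Fin.isValue,
      if_true, one_ne_zero, if_false]
  rw [e, Measure.pi_pi, Fin.prod_univ_two]
  simp

/-- ★★ **Cone mass of the two inner letters at a fixed outer letter.**  For a unit `q₃` with `|re q₃| < 1/2`, `0 ≤ t`,
`(1/2)^{K+1} ≤ t`: the product cone mass of the ball-model pairs `(x₀, x₂)` obeying (b), (c), (d), (a) is at most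
`Σ_{k ≤ K} 𝟙{|re q₃| ≤ 2t·2^{k+1}}·c²·2048t⁴ + c²·256t⁴` — the shell terms do not depend on `k` (no logarithm). [folklore] -/
theorem pi_cone_constraints_le {q₃ : ℍ} {t : ℝ} {K : ℕ} (h₃ : ‖q₃‖ = 1) (hr : |q₃.re| < 1 / 2) (ht : 0 ≤ t)
    (hK : (1 / 2 : ℝ) ^ (K + 1) ≤ t) :
    (Measure.pi fun _ : Fin 2 => coneMeasure)
        {x : Fin 2 → ℍ | (∀ j, ‖x j‖ < 1) ∧ ‖q₃ * x 1 - x 1 * q₃‖ ≤ t ∧ |q₃.re| * ‖q₃ * x 0 - x 0 * q₃‖ ≤ 2 * t ∧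
          ‖x 0 * (star q₃ * x 0 * q₃) - (star q₃ * x 0 * q₃) * x 0‖ ≤ 3 * t ∧ ‖x 0 * x 1 - x 1 * x 0‖ ≤ t} ≤
      (∑ k ∈ Finset.range (K + 1),
          {q : ℍ | |q.re| ≤ 2 * t * 2 ^ (k + 1)}.indicator (fun _ => ENNReal.ofReal (coneConst ^ 2 * (2048 * t ^ 4))) q₃) +
        ENNReal.ofReal (coneConst ^ 2 * (256 * t ^ 4)) := by
  haveI := isProbabilityMeasure_coneMeasure
  have hc := coneConst_pos
  -- the outer letter has a non-zero imaginary part, hence a straightening unit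
  have him : q₃.im ≠ 0 := by
    intro h0
    have h1 := sq_norm_im_eq q₃
    rw [h0, norm_zero, h₃] at h1
    have := abs_lt.1 hr
    nlinarith
  obtain ⟨u, hu, hstr⟩ := exists_unit_straighten him
  -- the covering by shell boxes and core boxes
  set Bc : Set ℍ := quatBox ![-1, -1, -t, -t] ![1, 1, t, t] with hBc
  set B0 : ℕ → Set ℍ := fun k => quatBox ![-1, -(t * 2 ^ (k + 1)), -((1 / 2 : ℝ) ^ k), -((1 / 2 : ℝ) ^ k)]
    ![1, t * 2 ^ (k + 1), (1 / 2 : ℝ) ^ k, (1 / 2 : ℝ) ^ k] with hB0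
  set B2 : ℕ → Set ℍ := fun k => quatBox ![-1, -(2 * t * 2 ^ (k + 1)), -t, -t] ![1, 2 * t * 2 ^ (k + 1), t, t] with hB2
  set f : ℍ → ℍ := fun x => star u * x * u with hf
  have hcover : {x : Fin 2 → ℍ | (∀ j, ‖x j‖ < 1) ∧ ‖q₃ * x 1 - x 1 * q₃‖ ≤ t ∧ |q₃.re| * ‖q₃ * x 0 - x 0 * q₃‖ ≤ 2 * t ∧
        ‖x 0 * (star q₃ * x 0 * q₃) - (star q₃ * x 0 * q₃) * x 0‖ ≤ 3 * t ∧ ‖x 0 * x 1 - x 1 * x 0‖ ≤ t} ⊆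
      (⋃ k ∈ Finset.range (K + 1), {x : Fin 2 → ℍ | |q₃.re| ≤ 2 * t * 2 ^ (k + 1) ∧ x 0 ∈ f ⁻¹' B0 k ∧ x 1 ∈ f ⁻¹' B2 k}) ∪
        {x : Fin 2 → ℍ | x 0 ∈ f ⁻¹' Bc ∧ x 1 ∈ f ⁻¹' Bc} := by
    intro x hx
    simp only [Set.mem_setOf_eq] at hx
    obtain ⟨hball, hb, hc', hd, ha⟩ := hx
    rcases mem_boxes_of_constraints (K := K) h₃ hr hu hstr ht hK (hball 0) (hball 1) hb hc' hd ha with hcore | ⟨k, hk, hrk, h0, h2⟩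
    · exact Or.inr hcore
    · refine Or.inl (Set.mem_iUnion₂.2 ⟨k, hk, ?_⟩)
      exact ⟨hrk, h0, h2⟩
  refine (measure_mono hcover).trans ((measure_union_le _ _).trans ?_)
  refine add_le_add ((measure_biUnion_finset_le _ _).trans (Finset.sum_le_sum fun k _ => ?_)) ?_
  · -- one shell
    by_cases hrk : |q₃.re| ≤ 2 * t * 2 ^ (k + 1)
    · rw [Set.indicator_of_mem (by exact hrk)]
      have e : {x : Fin 2 → ℍ | |q₃.re| ≤ 2 * t * 2 ^ (k + 1) ∧ x 0 ∈ f ⁻¹' B0 k ∧ x 1 ∈ f ⁻¹' B2 k} =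
          {x : Fin 2 → ℍ | x 0 ∈ f ⁻¹' B0 k ∧ x 1 ∈ f ⁻¹' B2 k} := by
        ext x; simp only [Set.mem_setOf_eq]; exact ⟨fun h => h.2, fun h => ⟨hrk, h⟩⟩
      rw [e, pi_two_apply_prod]
      have h0 := coneMeasure_preimage_conj_quatBox_le hu (lo := ![-1, -(t * 2 ^ (k + 1)), -((1 / 2 : ℝ) ^ k), -((1 / 2 : ℝ) ^ k)])
        (hi := ![1, t * 2 ^ (k + 1), (1 / 2 : ℝ) ^ k, (1 / 2 : ℝ) ^ k]) (by intro i; fin_cases i <;> (simp; try positivity))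
      have h2 := coneMeasure_preimage_conj_quatBox_le hu (lo := ![-1, -(2 * t * 2 ^ (k + 1)), -t, -t])
        (hi := ![1, 2 * t * 2 ^ (k + 1), t, t]) (by intro i; fin_cases i <;> simp <;> positivity)
      have h0' : coneMeasure (f ⁻¹' B0 k) ≤ ENNReal.ofReal (coneConst * (16 * t * (2 ^ (k + 1) * ((1 / 2 : ℝ) ^ k) ^ 2))) := by
        refine h0.trans (le_of_eq ?_)
        congr 1
        simp only [Matrix.cons_val_zero, Matrix.cons_val_one, Matrix.cons_val]
        ring
      have h2' : coneMeasure (f ⁻¹' B2 k) ≤ ENNReal.ofReal (coneConst * (32 * t ^ 3 * 2 ^ (k + 1))) := by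
        refine h2.trans (le_of_eq ?_)
        congr 1
        simp only [Matrix.cons_val_zero, Matrix.cons_val_one, Matrix.cons_val]
        ring
      refine (mul_le_mul' h0' h2').trans ?_
      rw [← ENNReal.ofReal_mul (by positivity)]
      refine ENNReal.ofReal_le_ofReal (le_of_eq ?_)
      have h2k : (2 : ℝ) ^ (k + 1) * (1 / 2) ^ k = 2 := by
        rw [pow_succ, one_div, inv_pow, mul_assoc, mul_comm (2 : ℝ) _, ← mul_assoc, mul_inv_cancel₀ (by positivity), one_mul]
      calc coneConst * (16 * t * (2 ^ (k + 1) * ((1 / 2 : ℝ) ^ k) ^ 2)) * (coneConst * (32 * t ^ 3 * 2 ^ (k + 1)))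
          = coneConst ^ 2 * (512 * t ^ 4) * ((2 : ℝ) ^ (k + 1) * (1 / 2) ^ k) ^ 2 := by ring
        _ = coneConst ^ 2 * (2048 * t ^ 4) := by rw [h2k]; ring
    · have e : {x : Fin 2 → ℍ | |q₃.re| ≤ 2 * t * 2 ^ (k + 1) ∧ x 0 ∈ f ⁻¹' B0 k ∧ x 1 ∈ f ⁻¹' B2 k} = ∅ := by
        ext x; simp only [Set.mem_setOf_eq, Set.mem_empty_iff_false, iff_false, not_and]; exact fun h => absurd h hrk
      rw [e, measure_empty]; exact bot_le
  · -- the core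
    rw [pi_two_apply_prod]
    have h0 := coneMeasure_preimage_conj_quatBox_le hu (lo := ![-1, -1, -t, -t]) (hi := ![1, 1, t, t])
      (by intro i; fin_cases i <;> simp <;> linarith)
    have h0' : coneMeasure (f ⁻¹' Bc) ≤ ENNReal.ofReal (coneConst * (16 * t ^ 2)) := by
      refine h0.trans (le_of_eq ?_)
      congr 1
      simp only [Matrix.cons_val_zero, Matrix.cons_val_one, Matrix.cons_val]
      ring
    refine (mul_le_mul' h0' h0').trans ?_
    rw [← ENNReal.ofReal_mul (by positivity)]
    refine ENNReal.ofReal_le_ofReal (le_of_eq ?_)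
    ring

end ConeMass


end Summit.QuantumFields.YangMills.Theorems.SwapVirialDeficit.SigmaTwistedCeiling

end
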